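/-
Origin: expansion seat `planner-pub-hodgecm-qw8-g11-0`, handover #16 SPLIT PART 1/2 of tree `HodgeCM/Model/Toy/LefQuadMixed.lean` 1602351a (484 l. > 400-line cap) = NEW module `HodgeCM.Model.Toy.LefQuadMixedEngine` md5 7676c6b811161a3e478f5d33f85aa385 (281 l.): verbatim section-boundary slice + docstrings; imports: NO rewrite (tree imports only: Mathlib, HodgeCM.Model.Toy.LefQuartic); check-wip LANDABLE rc 0 / 0 warnings / 0 proof-hole; lean -DautoImplicit=false rc  (`HOME/pub-hodgecm-qw8-g11/lean/Qw8g11/LefQuadMixedEngine.lean`, md5 7676c6b8, 281 lines);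
landed by the packager successor (mc-unitary-1-g3, gen-8 kit) in gate run 32 as `HodgeCM/Model/Toy/LefQuadMixedEngine.lean` (verbatim).
-/
-- HANDOVER (planner-pub-hodgecm-qw8-g11-0, unit pub-hodgecm-qw8-g11): SPLIT PART 1/2 of the installed
-- `HodgeCM.Model.Toy.LefQuadMixed` (md5 1602351a, 484 l.; 400-line cap, lean/CONVENTIONS.md) = its §§1–3 (ll. 49–275)
-- verbatim + docstrings; WIP module `Qw8g11.LefQuadMixedEngine`, intended final module `HodgeCM.Model.Toy.LefQuadMixedEngine`
-- (NEW file; tree imports only, NO rewrite).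
/-
Copyright (c) 2026. All rights reserved.
Released under Apache 2.0 license as described in the file LICENSE.
-/
import Mathlib
import Summits.HodgeConjecture.HodgeCM.Model.Toy.LefQuartic

/-!
# The Galois image on eigen-indices, signs, and the engine `TriOmega ⇒ CntBal`

Split part 1/2 of `HodgeCM.Model.Toy.LefQuadMixed` (its §§1–3, unchanged). `LefQuartic` summed sign vectors over the finite
Galois image `Ω_K ⊆ Sym(Hom(K,ℂ))` of ONE CM field; here the sums run over the Galois image `Ω_X ⊆ (X.Idx → X.Idx)` on the
eigen-indices of the object itself (§1 `Obj.Omega`), with the signs `sg s = ±1` of eigen-indices (§2, holomorphic `↦ 1`), and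
the engine `TriOmega X ⇒ CntBal X` (§3: if all pairwise inner products of slot sign vectors over `Ω_X` are `0` or `±#Ω_X`, the
counting-balance condition of `LefQuartic` holds) — the object-level form of `LefQuartic` §8. Sign characters, the
imaginary-quadratic atoms and the headlines are in `HodgeCM.Model.Toy.LefQuadMixed`.
Nothing is cited: kernel facts about an explicit model.
-/

noncomputable section

set_option backward.isDefEq.respectTransparency false

namespace HodgeCM.Toy

open scoped TensorProduct
open exteriorPower Module CMPresentation CMTypeOps
open NumberField.ComplexEmbedding (conjugate)
open Literature.AlgebraicGeometry.Motives

namespace Obj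

variable (X : Obj)

/-! ### 1. The Galois image on the eigen-indices of an object -/

/-- the identity of `Aut_ℚ(ℚ̄)` acts trivially on eigen-indices -/
theorem gact_one (s : X.Idx) : X.gact 1 s = s := by
  refine Sigma.ext rfl (heq_of_eq (RingHom.ext fun x => ?_))
  show (((1 : Gam) (X.liftE s x) : Qbar) : ℂ) = s.2 x
  rw [AlgEquiv.one_apply, coe_liftE]

/-- the Galois action on eigen-indices is multiplicative: `(γδ) • s = γ • (δ • s)` -/
theorem gact_mul (γ δ : Gam) (s : X.Idx) : X.gact (γ * δ) s = X.gact γ (X.gact δ s) := by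
  refine Sigma.ext rfl (heq_of_eq (RingHom.ext fun x => ?_))
  show (((γ * δ) (X.liftE s x) : Qbar) : ℂ) = ((γ (X.liftE (X.gact δ s) x) : Qbar) : ℂ)
  rw [AlgEquiv.mul_apply, liftE_gact_apply]

/-- `γ • (γ⁻¹ • s) = s` -/
theorem gact_symm_gact' (γ : Gam) (s : X.Idx) : X.gact γ (X.gact γ.symm s) = s := by
  simpa using X.gact_symm_gact γ.symm s

section Omega

open scoped Classical

/-- `Ω_X`: the finite set of permutations of the eigen-indices of `X` induced by `Aut_ℚ(ℚ̄)` (the image of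
the Galois action; no quotient of `Gam` is formed). -/
def Omega : Finset (X.Idx → X.Idx) := Finset.univ.filter fun ω => ∃ γ : Gam, ω = X.gact γ

variable {X}

/-- membership in the Galois image `Ω_X`: `ω ∈ Ω_X` iff `ω` is the action of some `γ ∈ Aut_ℚ(ℚ̄)` -/
theorem mem_Omega {ω : X.Idx → X.Idx} : ω ∈ X.Omega ↔ ∃ γ : Gam, ω = X.gact γ := by
  simp [Omega]

variable (X)

/-- every `γ` acts by an element of `Ω_X` -/
theorem gact_mem_Omega (γ : Gam) : X.gact γ ∈ X.Omega := mem_Omega.mpr ⟨γ, rfl⟩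

/-- `Ω_X` is nonempty (it contains the action of `1`) -/
theorem Omega_card_pos : 0 < X.Omega.card := Finset.card_pos.mpr ⟨_, X.gact_mem_Omega 1⟩

/-- `Ω_X` is stable under post-composition with the action of any `γ` -/
theorem comp_mem_Omega (γ : Gam) {ω : X.Idx → X.Idx} (hω : ω ∈ X.Omega) :
    (fun s => X.gact γ (ω s)) ∈ X.Omega := by
  obtain ⟨δ, rfl⟩ := mem_Omega.mp hω
  exact mem_Omega.mpr ⟨γ * δ, funext fun s => (X.gact_mul γ δ s).symm⟩

/-- reindexing a sum over `Ω_X` by left composition with `γ` -/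
theorem sum_Omega_comp {M : Type*} [AddCommMonoid M] (γ : Gam) (h : (X.Idx → X.Idx) → M) :
    ∑ ω ∈ X.Omega, h (fun s => X.gact γ (ω s)) = ∑ ω ∈ X.Omega, h ω := by
  refine Finset.sum_nbij' (fun ω s => X.gact γ (ω s)) (fun ω s => X.gact γ.symm (ω s))
    (fun ω hω => X.comp_mem_Omega γ hω) (fun ω hω => X.comp_mem_Omega γ.symm hω)
    (fun ω _ => funext fun s => X.gact_symm_gact γ (ω s))
    (fun ω _ => funext fun s => X.gact_symm_gact' γ (ω s)) (fun ω _ => rfl)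

end Omega

/-! ### 2. Signs of eigen-indices -/

section Sg

open scoped Classical

/-- the sign of an eigen-index: `+1` on the CM type, `-1` off it -/
def sg (s : X.Idx) : ℤ := if X.hol s then 1 else -1

variable {X}

/-- a holomorphic eigen-index has sign `1` -/
theorem sg_of_hol {s : X.Idx} (h : X.hol s) : X.sg s = 1 := by unfold sg; rw [if_pos h]

/-- a non-holomorphic eigen-index has sign `-1` -/
theorem sg_of_not_hol {s : X.Idx} (h : ¬ X.hol s) : X.sg s = -1 := by unfold sg; rw [if_neg h]

variable (X)

/-- `sg s = 1` iff `s` is holomorphic -/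
theorem sg_eq_one_iff (s : X.Idx) : X.sg s = 1 ↔ X.hol s := by
  by_cases h : X.hol s
  · rw [sg_of_hol h]; exact ⟨fun _ => h, fun _ => rfl⟩
  · rw [sg_of_not_hol h]; exact ⟨fun h' => absurd h' (by norm_num), fun h' => absurd h' h⟩

/-- signs are `±1` -/
theorem sg_eq_or (s : X.Idx) : X.sg s = 1 ∨ X.sg s = -1 := by
  by_cases h : X.hol s
  · exact Or.inl (sg_of_hol h)
  · exact Or.inr (sg_of_not_hol h)

/-- `sg s * sg s = 1` -/
theorem sg_mul_self (s : X.Idx) : X.sg s * X.sg s = 1 := by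
  rcases X.sg_eq_or s with h | h <;> rw [h] <;> norm_num

/-- conjugating an eigen-index flips its sign -/
theorem sg_bar (s : X.Idx) : X.sg (X.bar s) = -X.sg s := by
  by_cases h : X.hol s
  · rw [sg_of_hol h, sg_of_not_hol (fun h' => (X.hol_bar_iff s).mp h' h)]
  · rw [sg_of_not_hol h, sg_of_hol ((X.hol_bar_iff s).mpr h), neg_neg]

/-- twisting an eigen-index by `κ` flips its sign -/
theorem sg_gact_kap (s : X.Idx) : X.sg (X.gact kap s) = -X.sg s := by
  rw [gact_kap, sg_bar]

/-- a sign function sums to zero over `Ω_X` at every slot (complex conjugation `κ ∈ Γ` flips it) -/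
theorem sum_Omega_sg (s : X.Idx) : ∑ ω ∈ X.Omega, X.sg (ω s) = 0 := by
  have h := X.sum_Omega_comp kap fun ω => X.sg (ω s)
  simp only [sg_gact_kap, Finset.sum_neg_distrib] at h
  linarith

end Sg

/-! ### 3. The engine: extremal-or-zero inner products over `Ω_X` give `CntBal` -/

section Engine

open scoped Classical

/-- the trichotomy over `Ω_X`: for any two eigen-indices the inner product of their sign vectors
`ω ↦ sg(ω s)`, `ω ↦ sg(ω t)` over `Ω_X` is `0` or `±#Ω_X` -/
def TriOmega : Prop :=
  ∀ s t : X.Idx, Trichot X.Omega.card (∑ ω ∈ X.Omega, X.sg (ω s) * X.sg (ω t))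

/-- **`TriOmega ⇒ CntBal`** (the object-level form of `LefQuartic`'s `Obj.cntBal_of_triInner`): read slot
`j` of an index map `g` through its sign vector `ψ_j(ω) = sg(ω (g j))` on `Ω_X`.  Constant holomorphy count
makes `Σ_j ψ_j` constant on `Ω_X`; each `ψ_l` sums to zero; so `Σ_j ⟨ψ_j, ψ_l⟩ = 0`, and with every
`⟨ψ_j, ψ_l⟩ ∈ {0, ±#Ω_X}` (`+` iff the Galois types agree, `-` iff they are complementary) the types of
`g` pair off: `#{j : T_j = T} = #{j : T_j = Tᶜ}`. -/
theorem cntBal_of_triOmega (hT : X.TriOmega) : X.CntBal := by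
  intro k g _ hcnt
  -- the sign vectors
  obtain ⟨ψ, hψ⟩ : ∃ ψ : Fin k → (X.Idx → X.Idx) → ℤ, ∀ j ω, ψ j ω = X.sg (ω (g j)) := ⟨_, fun _ _ => rfl⟩
  have hψpm : ∀ j, ∀ ω ∈ X.Omega, ψ j ω = 1 ∨ ψ j ω = -1 := fun j ω _ => by rw [hψ]; exact X.sg_eq_or _
  -- (H1) `Σ_j ψ_j(γ) = 2·cnt(γ • g) - k`, constant on `Ω_X`
  have hsumψ : ∀ γ : Gam, ∑ j, ψ j (X.gact γ) = 2 * (X.cnt (fun i => X.gact γ (g i)) : ℤ) - k := by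
    intro γ
    rw [X.cnt_eq_card_filter, Finset.card_filter]
    push_cast
    rw [Finset.mul_sum]
    have hk : (k : ℤ) = ∑ _j : Fin k, (1 : ℤ) := by simp
    rw [hk, ← Finset.sum_sub_distrib]
    refine Finset.sum_congr rfl fun j _ => ?_
    rw [hψ]
    by_cases hh : X.hol (X.gact γ (g j))
    · rw [sg_of_hol hh, if_pos hh]; norm_num
    · rw [sg_of_not_hol hh, if_neg hh]; norm_num
  have hconst : ∀ ω ∈ X.Omega, ∑ j, ψ j ω = 2 * (X.cnt (fun i => X.gact 1 (g i)) : ℤ) - k := by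
    intro ω hω
    obtain ⟨γ, rfl⟩ := mem_Omega.mp hω
    rw [hsumψ γ, hcnt γ 1]
  -- (H2) each `ψ_l` sums to zero over `Ω_X`
  have hzero : ∀ l, ∑ ω ∈ X.Omega, ψ l ω = 0 := fun l => by
    rw [← X.sum_Omega_sg (g l)]
    exact Finset.sum_congr rfl fun ω _ => hψ l ω
  -- (H3) `⟨ψ_j, ψ_l⟩ ∈ {0, ±#Ω}`
  have htri : ∀ j l, Trichot X.Omega.card (∑ ω ∈ X.Omega, ψ j ω * ψ l ω) := fun j l => by
    have heq : ∑ ω ∈ X.Omega, ψ j ω * ψ l ω = ∑ ω ∈ X.Omega, X.sg (ω (g j)) * X.sg (ω (g l)) :=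
      Finset.sum_congr rfl fun ω _ => by rw [hψ, hψ]
    rw [heq]; exact hT (g j) (g l)
  -- (H4) `ψ_j = ψ_l` on `Ω_X` iff `T_j = T_l`; `ψ_j = -ψ_l` iff `T_j = T_lᶜ`
  have hTeq : ∀ j l, (∀ ω ∈ X.Omega, ψ j ω = ψ l ω) ↔ X.typ (g j) = X.typ (g l) := by
    intro j l
    constructor
    · intro h
      ext γ
      rw [Obj.mem_typ, Obj.mem_typ, ← sg_eq_one_iff, ← sg_eq_one_iff, ← hψ, ← hψ, h _ (X.gact_mem_Omega γ)]
    · intro h ω hω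
      obtain ⟨γ, rfl⟩ := mem_Omega.mp hω
      have hγ : X.hol (X.gact γ (g j)) ↔ X.hol (X.gact γ (g l)) := by rw [← Obj.mem_typ, ← Obj.mem_typ, h]
      rw [hψ, hψ]
      by_cases hm : X.hol (X.gact γ (g j))
      · rw [sg_of_hol hm, sg_of_hol (hγ.mp hm)]
      · rw [sg_of_not_hol hm, sg_of_not_hol (fun h' => hm (hγ.mpr h'))]
  have hTcompl : ∀ j l, (∀ ω ∈ X.Omega, ψ j ω = -ψ l ω) ↔ X.typ (g j) = (X.typ (g l))ᶜ := by
    intro j l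
    constructor
    · intro h
      ext γ
      rw [Set.mem_compl_iff, Obj.mem_typ, Obj.mem_typ, ← sg_eq_one_iff, ← sg_eq_one_iff, ← hψ, ← hψ,
        h _ (X.gact_mem_Omega γ)]
      rcases hψpm l _ (X.gact_mem_Omega γ) with h1 | h1 <;> rw [h1] <;> norm_num
    · intro h ω hω
      obtain ⟨γ, rfl⟩ := mem_Omega.mp hω
      have hγ : X.hol (X.gact γ (g j)) ↔ ¬ X.hol (X.gact γ (g l)) := by
        rw [← Obj.mem_typ, ← Obj.mem_typ, h, Set.mem_compl_iff]
      rw [hψ, hψ]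
      by_cases hm : X.hol (X.gact γ (g j))
      · rw [sg_of_hol hm, sg_of_not_hol (hγ.mp hm)]; norm_num
      · rw [sg_of_not_hol hm, sg_of_hol (not_not.mp fun h' => hm (hγ.mpr h'))]
  -- (H5) so `⟨ψ_j, ψ_l⟩ = #Ω · ([T_j = T_l] - [T_j = T_lᶜ])`
  have hval : ∀ j l, ∑ ω ∈ X.Omega, ψ j ω * ψ l ω
      = X.Omega.card * ((if X.typ (g j) = X.typ (g l) then 1 else 0)
          - (if X.typ (g j) = (X.typ (g l))ᶜ then 1 else 0)) := by
    intro j l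
    by_cases h1 : X.typ (g j) = X.typ (g l)
    · have h2 : X.typ (g j) ≠ (X.typ (g l))ᶜ := by rw [h1]; exact Obj.set_ne_compl _
      rw [if_pos h1, if_neg h2, sub_zero, mul_one]
      exact sum_mul_eq_card_of_eq _ _ _ ((hTeq j l).mpr h1) (hψpm l)
    by_cases h2 : X.typ (g j) = (X.typ (g l))ᶜ
    · rw [if_neg h1, if_pos h2, zero_sub, mul_neg, mul_one]
      exact sum_mul_eq_neg_card_of_eq_neg _ _ _ ((hTcompl j l).mpr h2) (hψpm l)
    rw [if_neg h1, if_neg h2, sub_zero, mul_zero]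
    rcases htri j l with h | h | h
    · exact h
    · exact absurd ((hTeq j l).mp (eq_of_sum_mul_eq_card _ _ _ (hψpm j) (hψpm l) h)) h1
    · exact absurd ((hTcompl j l).mp (eq_neg_of_sum_mul_eq_neg_card _ _ _ (hψpm j) (hψpm l) h)) h2
  -- summing over `j`: `#{j : T_j = T_l} = #{j : T_j = T_lᶜ}`
  have key : ∀ l, X.tcnt g (X.typ (g l)) = X.tcnt g (X.typ (g l))ᶜ := by
    intro l
    have hsum0 : ∑ j, ∑ ω ∈ X.Omega, ψ j ω * ψ l ω = 0 := by
      rw [Finset.sum_comm]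
      calc ∑ ω ∈ X.Omega, ∑ j, ψ j ω * ψ l ω
          = ∑ ω ∈ X.Omega, (2 * (X.cnt (fun i => X.gact 1 (g i)) : ℤ) - k) * ψ l ω :=
            Finset.sum_congr rfl fun ω hω => by rw [← Finset.sum_mul, hconst ω hω]
        _ = 0 := by rw [← Finset.mul_sum, hzero l, mul_zero]
    have hsum1 : (X.Omega.card : ℤ) * (∑ j, ((if X.typ (g j) = X.typ (g l) then 1 else 0)
        - (if X.typ (g j) = (X.typ (g l))ᶜ then 1 else 0) : ℤ)) = ∑ j, ∑ ω ∈ X.Omega, ψ j ω * ψ l ω := by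
      rw [Finset.mul_sum]
      exact Finset.sum_congr rfl fun j _ => (hval j l).symm
    rw [hsum0] at hsum1
    have hne : (X.Omega.card : ℤ) ≠ 0 := by exact_mod_cast X.Omega_card_pos.ne'
    have h := (mul_eq_zero.mp hsum1).resolve_left hne
    rw [Finset.sum_sub_distrib, sub_eq_zero] at h
    rw [X.tcnt_eq_card_filter, X.tcnt_eq_card_filter, Finset.card_filter, Finset.card_filter]
    exact_mod_cast h
  -- balance
  intro T
  by_cases h1 : ∃ l, X.typ (g l) = T
  · obtain ⟨l, rfl⟩ := h1
    exact key l
  by_cases h2 : ∃ l, X.typ (g l) = Tᶜ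
  · obtain ⟨l, hl⟩ := h2
    have h := key l
    rw [hl, compl_compl] at h
    exact h.symm
  rw [X.tcnt_eq_card_filter, X.tcnt_eq_card_filter,
    Finset.card_eq_zero.mpr (Finset.filter_eq_empty_iff.mpr fun j _ hj => h1 ⟨j, hj⟩),
    Finset.card_eq_zero.mpr (Finset.filter_eq_empty_iff.mpr fun j _ hj => h2 ⟨j, hj⟩)]

end Engine

end Obj

end HodgeCM.Toy

end
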